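import Summits.KontsevichZagierPeriods.KontsevichZagierPeriods.Theses.TerasomaMultiplication
import Summits.KontsevichZagierPeriods.KontsevichZagierPeriods.Theses.MotivatedMoves
import Summits.KontsevichZagierPeriods.KontsevichZagierPeriods.Theorems.CompleteModGammaSector.Negative.LoadBearing
import Summits.KontsevichZagierPeriods.KontsevichZagierPeriods.Theorems.TerasomaMultiplicationCompleteModGammaSectorResidualAbsorption

/-!
# `CompleteModGammaSector` — the two route forms are one statement (stmt-KontsevichZagierPeriods-14233)

The crux CONJECTURE 1 MODULO THE Γ-SECTOR is ONE ledger item shared by two routes, each of which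
declares it in its own route file with the SAME body:
`Summit.KontsevichZagierPeriods.KontsevichZagierPeriods.Theses.TerasomaMultiplication.CompleteModGammaSector`
(crux 7 of TerasomaMultiplication) and
`Summit.KontsevichZagierPeriods.KontsevichZagierPeriods.Theses.MotivatedMoves.CompleteModGammaSector`
(crux (ii) of MotivatedMoves). All kernel-checked knowledge about the crux — the kernel form
`crux ↔ ker eval ≤ sector` and `summit → crux` (`CompleteModGammaSectorNegative`, p79902), residual
absorption (`…ResidualAbsorption`, p112253), the line theorems — is stated for the
TerasomaMultiplication declaration. This file records the definitional identity of the two forms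
(`Iff.rfl`) and transports those structural facts to the MotivatedMoves declaration, so that either
route's planners and disprovers can cite them by name (requested in the item text: "landing the
link with --supports re-shares every result between the two forms"). No mathematics beyond
unfolding; nothing here lowers the crux, which is Conjecture 1 of Kontsevich–Zagier relative to
the Deligne–Koblitz–Ogus Γ-identities (GPC strength).

References: M. Kontsevich, D. Zagier, *Periods* (2001), §1.2 Conjecture 1.
-/

noncomputable section

-- `Summit.KontsevichZagierPeriods.KontsevichZagierPeriods.…` is the tree's mandated layout (single-conjunct summit).
set_option linter.dupNamespace false

namespace Summit.KontsevichZagierPeriods.KontsevichZagierPeriods.CompleteModGammaSectorSharedForms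

open Literature.NumberTheory.Transcendental
open Literature.NumberTheory.Transcendental.KZ
open Summit.KontsevichZagierPeriods.CompleteModGammaSectorNegative
  (sector completeModGammaSector_iff_ker_le of_summit summit_false_of_not)
open Summit.KontsevichZagierPeriods.KontsevichZagierPeriods.CompleteModGammaSectorResidualAbsorption
  (completeModGammaSector_iff_residual_of_le_sector)

/-- **The two route forms of the crux are definitionally one statement**: MotivatedMoves' crux (ii)
`CompleteModGammaSector` and TerasomaMultiplication's crux 7 `CompleteModGammaSector` have the same
body (one shared ledger item, stmt-KontsevichZagierPeriods-14233). [cite: KontsevichZagier2001, §1.2 Conjecture 1] -/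
theorem motivatedMoves_iff_terasoma :
    Theses.MotivatedMoves.CompleteModGammaSector ↔ Theses.TerasomaMultiplication.CompleteModGammaSector :=
  Iff.rfl

/-- Kernel form of the MotivatedMoves declaration: crux (ii) holds iff every value-zero formal
combination lies in `sector = relations ⊔ closure gammaHodgePairs`
(`CompleteModGammaSectorNegative.completeModGammaSector_iff_ker_le`, transported). [cite: KontsevichZagier2001, §1.2 Conjecture 1] -/
theorem motivatedMoves_iff_ker_le :
    Theses.MotivatedMoves.CompleteModGammaSector ↔ eval.ker ≤ sector :=
  motivatedMoves_iff_terasoma.trans completeModGammaSector_iff_ker_le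

/-- The summit implies MotivatedMoves' crux (ii) (`CompleteModGammaSectorNegative.of_summit`,
transported): the crux is never stronger than Conjecture 1. [cite: KontsevichZagier2001, §1.2 Conjecture 1] -/
theorem motivatedMoves_of_summit (h : _root_.KontsevichZagierPeriods) :
    Theses.MotivatedMoves.CompleteModGammaSector :=
  motivatedMoves_iff_terasoma.mpr (of_summit h)

/-- A refutation of MotivatedMoves' crux (ii) refutes the summit
(`CompleteModGammaSectorNegative.summit_false_of_not`, transported). [cite: KontsevichZagier2001, §1.2 Conjecture 1] -/
theorem summit_false_of_not_motivatedMoves (h : ¬ Theses.MotivatedMoves.CompleteModGammaSector) :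
    ¬ _root_.KontsevichZagierPeriods :=
  summit_false_of_not fun hc => h (motivatedMoves_iff_terasoma.mpr hc)

/-- **Residual absorption for the MotivatedMoves form**: for every subgroup `S ≤ sector` (the output
of any line proving a sector of Conjecture 1, possibly using Γ-pairs), crux (ii) is EQUIVALENT to
the residual `ker eval ≤ sector ⊔ S` the line leaves behind
(`…ResidualAbsorption.completeModGammaSector_iff_residual_of_le_sector`, transported) — the reason
every sector-lever line on this item died at a crux-equivalent stub. [cite: KontsevichZagier2001, §1.2 Conjecture 1] -/
theorem motivatedMoves_iff_residual_of_le_sector (S : AddSubgroup FormalRep) (hS : S ≤ sector) :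
    Theses.MotivatedMoves.CompleteModGammaSector ↔ eval.ker ≤ sector ⊔ S :=
  motivatedMoves_iff_terasoma.trans (completeModGammaSector_iff_residual_of_le_sector S hS)

end Summit.KontsevichZagierPeriods.KontsevichZagierPeriods.CompleteModGammaSectorSharedForms

end
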